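import Literature.Computability.Cryptography.PeriodFindingBoxPoisson
import Literature.Computability.Cryptography.PeriodFindingRunTails
import Mathlib.RingTheory.RootsOfUnity.Complex
import HarnessLib

/-!
# Box character sums of ONE coset of a lattice: the approximate Poisson expansion

Topic `Computability/Cryptography` (harmonic analysis of period finding over `ℤ^T`); theorem-only file, no named facts.
Sequel of `PeriodFindingBoxPoisson.lean` (the EXACT identity for the sum over all cosets).

For a finite-index subgroup `Λ ≤ ℤ^T` with quotient `G = ℤ^T/Λ` and a real frequency `θ`, the character sum over the box
points of a single coset `g`,
`B_g(θ) = ∑_{e ∈ [0,M)^T, ē = g} e(θ·e)`,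
expands over the characters `χ` of `G` (orthogonality `1_{ē = g} = |G|⁻¹ ∑_χ χ(ē − g)`) into
`B_g(θ) = |G|⁻¹ ∑_χ χ(−g) ∏_i D_{i,χ}`, `D_{i,χ} = ∑_{x<M} (e(θ_i) χ(ē_i))^x` — a combination of PRODUCTS OF ONE-DIMENSIONAL
DIRICHLET KERNELS, one per character (`boxCosetSum_eq`). Near the peak of one character `χ₀` every other kernel product is
small, because a nontrivial character of `G` moves some unit vector `ē_i` by an `|G|`-th root of unity `≠ 1`
(`exists_norm_one_sub_apply_single_ge`), so `|B_g|²` is `|G|⁻²|∏_i D_{i,χ₀}|²` up to a controlled cross term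
(`norm_sq_add_ge`): each coset ALONE reproduces the uniform mixture over the dual group, up to `O(|G|²/M)`.
This is what makes the class weights of Hallgren's class-group table irrelevant. [Hallgren2005, §4]

## References

* S. Hallgren, *Fast quantum algorithms for computing the unit group and class group of a number field*, STOC 2005, §4.
  [Hallgren2005]
* A. Yu. Kitaev, arXiv:quant-ph/9511026 (1995), §4. [Kitaev1995]
-/

noncomputable section

namespace Literature.Computability.Cryptography

namespace PeriodFinding

open Complex Finset

variable {T : ℕ}

/-- `‖a + r‖² ≥ ‖a‖² − 2‖a‖‖r‖` (the main term minus the cross term). [folklore] -/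
theorem norm_sq_add_ge (a r : ℂ) : ‖a‖ ^ 2 - 2 * ‖a‖ * ‖r‖ ≤ ‖a + r‖ ^ 2 := by
  have h1 : ‖a‖ - ‖r‖ ≤ ‖a + r‖ := by
    have := norm_sub_norm_le a (-r)
    rw [norm_neg, sub_neg_eq_add] at this
    linarith [abs_sub_abs_le_abs_sub ‖a‖ ‖r‖, norm_add_le a r, norm_nonneg (a + r),
      (abs_norm_sub_norm_le a (a + r))]
  rcases le_or_gt ‖r‖ ‖a‖ with h | h
  · have h2 : 0 ≤ ‖a‖ - ‖r‖ := sub_nonneg.2 h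
    nlinarith [pow_le_pow_left₀ h2 h1 2, norm_nonneg r]
  · nlinarith [norm_nonneg a, norm_nonneg r, norm_nonneg (a + r)]

section Lattice

variable (Λ : AddSubgroup (Fin T → ℤ))


/-- **The character expansion of the box character sum of one coset.** For `g ∈ ℤ^T/Λ` (finite):
`∑_{e ∈ [0,M)^T, ē = g} e(θ·e) = |G|⁻¹ ∑_{χ} χ(−g) ∏_i ∑_{x<M} e(θ_i x) χ(ē_i)^x`. Proof: insert
`1_{ē = g} = |G|⁻¹ ∑_χ χ(ē − g)` (`AddChar.sum_apply_eq_ite`) and factorise `e(θ·e) χ(ē) = ∏_i e(θ_i e_i) χ(ē_i)^{e_i}`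
over the box (`Finset.prod_univ_sum`). [cite: Hallgren2005, §4] -/
theorem boxCosetSum_eq [Fintype ((Fin T → ℤ) ⧸ Λ)] [DecidableEq ((Fin T → ℤ) ⧸ Λ)] (M : ℕ) (θ : Fin T → ℝ)
    (g : (Fin T → ℤ) ⧸ Λ) :
    ∑ e ∈ (boxT T M).filter (fun e => (QuotientAddGroup.mk (toZ e) : (Fin T → ℤ) ⧸ Λ) = g), eR θ (toZ e) =
      (1 / (Fintype.card ((Fin T → ℤ) ⧸ Λ) : ℂ)) * ∑ χ : AddChar ((Fin T → ℤ) ⧸ Λ) ℂ,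
        χ (-g) * ∏ i : Fin T, ∑ x ∈ range M, e1 (θ i) x * χ (QuotientAddGroup.mk (Pi.single i 1)) ^ x := by
  classical
  have hG0 : (Fintype.card ((Fin T → ℤ) ⧸ Λ) : ℂ) ≠ 0 := by exact_mod_cast Fintype.card_ne_zero
  -- the indicator of the coset through the characters
  have hind : ∀ e : Fin T → ℕ,
      (if (QuotientAddGroup.mk (toZ e) : ((Fin T → ℤ) ⧸ Λ)) = g then (1 : ℂ) else 0) =
        (1 / (Fintype.card ((Fin T → ℤ) ⧸ Λ) : ℂ)) * ∑ χ : AddChar ((Fin T → ℤ) ⧸ Λ) ℂ, χ ((QuotientAddGroup.mk (toZ e) : ((Fin T → ℤ) ⧸ Λ)) - g) := by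
    intro e
    simp only [AddChar.sum_apply_eq_ite, sub_eq_zero]
    split_ifs <;> simp [hG0]
  -- the coordinate factorisation `e(θ·e) χ(ē) = ∏_i e(θ_i e_i) χ(ē_i)^{e_i}`
  have hchar : ∀ (χ : AddChar ((Fin T → ℤ) ⧸ Λ) ℂ) (e : Fin T → ℕ),
      eR θ (toZ e) * χ (QuotientAddGroup.mk (toZ e)) =
        ∏ i : Fin T, e1 (θ i) (e i) * χ (QuotientAddGroup.mk (Pi.single i 1)) ^ (e i) := by
    intro χ e
    rw [prod_mul_distrib, ← eR_toZ_eq_prod]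
    congr 1
    have : toZ e = ∑ i : Fin T, (e i) • (Pi.single i (1 : ℤ) : Fin T → ℤ) := by
      ext j
      simp [toZ, Finset.sum_apply, Pi.single_apply]
    rw [this]
    show χ ((QuotientAddGroup.mk' Λ) (∑ i, e i • (Pi.single i (1 : ℤ) : Fin T → ℤ))) =
      ∏ x, χ ((QuotientAddGroup.mk' Λ) (Pi.single x 1)) ^ e x
    rw [map_sum, addChar_map_sum]
    refine prod_congr rfl fun i _ => ?_
    rw [map_nsmul, AddChar.map_nsmul_eq_pow]
  -- assemble
  rw [sum_filter]
  have h1 : ∀ e ∈ boxT T M, (if (QuotientAddGroup.mk (toZ e) : ((Fin T → ℤ) ⧸ Λ)) = g then eR θ (toZ e) else 0) =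
      (1 / (Fintype.card ((Fin T → ℤ) ⧸ Λ) : ℂ)) * ∑ χ : AddChar ((Fin T → ℤ) ⧸ Λ) ℂ, χ (-g) * (eR θ (toZ e) * χ (QuotientAddGroup.mk (toZ e))) := by
    intro e _
    rw [show (if (QuotientAddGroup.mk (toZ e) : ((Fin T → ℤ) ⧸ Λ)) = g then eR θ (toZ e) else 0) =
        eR θ (toZ e) * (if (QuotientAddGroup.mk (toZ e) : ((Fin T → ℤ) ⧸ Λ)) = g then (1 : ℂ) else 0) by split_ifs <;> simp,
      hind e, mul_sum, mul_sum, mul_sum]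
    refine sum_congr rfl fun χ _ => ?_
    rw [AddChar.map_sub_eq_div, div_eq_mul_inv (χ (QuotientAddGroup.mk (toZ e))) (χ g), ← AddChar.map_neg_eq_inv]
    ring
  rw [sum_congr rfl h1, ← mul_sum, sum_comm]
  congr 1
  refine sum_congr rfl fun χ _ => ?_
  rw [← mul_sum]
  congr 1
  rw [sum_congr rfl fun e _ => hchar χ e]
  exact (prod_univ_sum (fun _ : Fin T => range M)
    (fun i x => e1 (θ i) x * χ (QuotientAddGroup.mk (Pi.single i 1)) ^ x)).symm

/-- **A nontrivial character moves some unit vector by a root of unity `≠ 1`, hence by at least `4/|G|`.** In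
`G = ℤ^T/Λ` (finite of order `h`), the classes `ē_i` of the unit vectors generate, a character `χ ≠ 0` has some
`χ(ē_i) ≠ 1`, and `χ(ē_i)` is an `h`-th root of unity, so `‖1 − χ(ē_i)‖ = 2 sin(π j/h) ≥ 2 sin(π/h) ≥ 4/h`.
[folklore] -/
theorem exists_norm_one_sub_apply_single_ge [Fintype ((Fin T → ℤ) ⧸ Λ)] (χ : AddChar ((Fin T → ℤ) ⧸ Λ) ℂ)
    (hχ : χ ≠ 0) :
    ∃ i : Fin T, (4 : ℝ) / Fintype.card ((Fin T → ℤ) ⧸ Λ) ≤ ‖1 - χ (QuotientAddGroup.mk (Pi.single i 1))‖ := by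
  classical
  set h := Fintype.card ((Fin T → ℤ) ⧸ Λ) with hh
  -- some unit vector is moved
  have hex : ∃ i : Fin T, χ (QuotientAddGroup.mk (Pi.single i 1) : ((Fin T → ℤ) ⧸ Λ)) ≠ 1 := by
    by_contra hall
    push Not at hall
    apply hχ
    ext a
    obtain ⟨v, rfl⟩ := QuotientAddGroup.mk_surjective a
    have hv : v = ∑ i : Fin T, (v i) • (Pi.single i (1 : ℤ) : Fin T → ℤ) := by
      ext j; simp [Finset.sum_apply, Pi.single_apply]
    rw [AddChar.zero_apply, hv]
    show χ ((QuotientAddGroup.mk' Λ) (∑ i, v i • (Pi.single i (1 : ℤ) : Fin T → ℤ))) = 1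
    rw [map_sum, addChar_map_sum]
    refine prod_eq_one fun i _ => ?_
    rw [map_zsmul, AddChar.map_zsmul_eq_zpow]
    change χ (QuotientAddGroup.mk (Pi.single i 1)) ^ (v i) = 1
    rw [hall i, one_zpow]
  obtain ⟨i, hi⟩ := hex
  refine ⟨i, ?_⟩
  set z : ℂ := χ (QuotientAddGroup.mk (Pi.single i 1) : ((Fin T → ℤ) ⧸ Λ)) with hz
  -- `z` is an `h`-th root of unity, `z = ζ^j` with `0 < j < h`
  have hzh : z ^ h = 1 := by
    rw [hz, ← AddChar.map_nsmul_eq_pow, hh, card_nsmul_eq_zero, AddChar.map_zero_eq_one]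
  have hhpos : 0 < h := Fintype.card_pos
  have hζ : IsPrimitiveRoot (cexp (2 * Real.pi * I / h)) h := Complex.isPrimitiveRoot_exp h hhpos.ne'
  obtain ⟨j, hjh, hjz⟩ := hζ.eq_pow_of_pow_eq_one hzh
  have hj0 : 0 < j := by
    rcases Nat.eq_zero_or_pos j with rfl | hj
    · rw [pow_zero] at hjz; exact absurd hjz.symm hi
    · exact hj
  have hhR : (0 : ℝ) < h := by exact_mod_cast hhpos
  have hsinpos : 0 < Real.sin (Real.pi * j / h) := by
    apply Real.sin_pos_of_pos_of_lt_pi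
    · positivity
    · rw [div_lt_iff₀ hhR]
      have : (j : ℝ) < h := by exact_mod_cast hjh
      nlinarith [Real.pi_pos]
  have hnorm : ‖1 - z‖ = 2 * Real.sin (Real.pi * j / h) := by
    rw [← hjz, ← Complex.exp_nat_mul, norm_sub_rev,
      show (j : ℂ) * (2 * Real.pi * I / h) = I * ((2 * Real.pi * j / h : ℝ) : ℂ) by push_cast; field_simp,
      Complex.norm_exp_I_mul_ofReal_sub_one, show (2 * Real.pi * j / h : ℝ) / 2 = Real.pi * j / h by ring,
      Real.norm_eq_abs, abs_of_pos (mul_pos two_pos hsinpos)]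
  rw [hnorm]
  have hle := two_mul_min_div_le_sin hj0 hjh
  have hmin : (1 : ℝ) ≤ ((min j (h - j) : ℕ) : ℝ) := by
    exact_mod_cast (show 1 ≤ min j (h - j) from le_min hj0 (by omega))
  calc (4 : ℝ) / h = 2 * (2 * 1 / h) := by ring
    _ ≤ 2 * (2 * ((min j (h - j) : ℕ) : ℝ) / h) := by gcongr
    _ ≤ 2 * Real.sin (Real.pi * j / h) := by linarith

end Lattice

end PeriodFinding

end Literature.Computability.Cryptography
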